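import Summits.ResolutionOfSingularities.ResolutionOfSingularities.Theses.PAlteration
import Summits.ResolutionOfSingularities.ResolutionOfSingularities.Theorems.PAlterationPialtRadicialCoverKit
import Summits.ResolutionOfSingularities.ResolutionOfSingularities.Theorems.PAlterationPialtCommonPurelyInseparable
import Summits.ResolutionOfSingularities.ResolutionOfSingularities.Theorems.PAlterationPialtZariskiLocalResolution
import Summits.ResolutionOfSingularities.ResolutionOfSingularities.Theorems.PAlterationPialtKnownCases
import HarnessLib

/-!
# `Pialt` (crux stmt-ResolutionOfSingularities-0555), line `SketchIdeator2` / Card A: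
# the Picover atlas of `Z^L` and `stub_radicialPatching` over ANY field of characteristic `p`

Helper file (`--supports stmt-ResolutionOfSingularities-0555`; STUB-PLAN
`Cruxes/Pialt/STUB-PLAN-stub_radicialPatching.md`, helpers H1, H6 and the plan's assembly §3, in
which perfectness of the ground field is NOT used — the perfect-field case, by Frobenius
domination, is `PAlterationPialtStubRadicialPatchingOfAtoms.lean`).

Let `Z` be a NORMAL integral separated scheme of finite type over a field `k` of characteristic
`p`, every point of which has a RADICIALLY REGULAR open neighbourhood (`Uᵢ` dominated by an
integral regular `Wᵢ` through a finite, universally injective, surjective `wᵢ : Wᵢ → Uᵢ`).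

* `exists_normalizationIn_forall_picoverChart` (H6, with the finite atlas H1 inlined) — there is
  ONE finite purely inseparable `L ⊇ K(Z)` such that every point of the normalisation `Z^L` has
  an open neighbourhood `O` which is a finite, universally injective, surjective cover of a
  REGULAR integral separated `k`-scheme of finite type (a "Picover chart"): take a finite atlas
  `U₁, …, Uₙ`; extend each `wᵢ` to a global finite radicial normal cover `hᵢ : Z₁ᵢ → Z` with
  `Wᵢ = Z₁ᵢ ×_Z Uᵢ` (`exists_finite_radicial_cover_extending`); embed all `K(Z₁ᵢ)` into one finite
  purely inseparable `L` (`exists_common_purelyInseparable_extension`); then `Z^L → Z₁ᵢ` is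
  finite, universally injective, surjective over `Z`
  (`exists_finite_universallyInjective_hom_normalizationIn`), and over `Uᵢ` it restricts to a
  cover `O → Wᵢ` of the regular `Wᵢ`.
* `radicialPatching_of_picover_of_twoModelPatching_anyField` — hence, modulo the route's crux
  `Picover`, `ProperModel.TwoModelPatching p` and `NagataCompactification`, the conclusion of
  `Pialt` holds at `Z` over ANY field of characteristic `p`: `Picover` resolves every chart `O`,
  weak resolution is Zariski-local (`hasResolution_of_forall_exists_open_hasResolution`), so
  `Z^L` is resolvable, and `pialtConclusion_of_hasResolution_normalizationIn` concludes.

Sources: A. J. de Jong, Publ. Math. IHÉS 83 (1996), 4.16–4.17; M. Temkin, J. Algebra 373 (2013),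
§1.3, Rem. 1.3.5; O. Piltant, RACSAM 107 (2013), Prop. 5.1; Stacks Project, Tags 035H–035I.
-/

set_option linter.dupNamespace false -- mandated namespace of this single-conjunct summit

noncomputable section

open CategoryTheory CategoryTheory.Limits AlgebraicGeometry TopologicalSpace
open Literature.AlgebraicGeometry.Resolution
open Literature.AlgebraicGeometry.Motives
open Literature.AlgebraicGeometry.Morphisms (NagataCompactification)

namespace Summit.ResolutionOfSingularities.ResolutionOfSingularities.Theorems.Pialt.RadiciallyRegular

set_option maxHeartbeats 800000 in
-- many `choose`s over a finite atlas; instance-heavy function-field bookkeeping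
/-- **The Picover atlas of `Z^L`** (H6 of the stub plan). For a NORMAL integral separated scheme
`Z` of finite type over a field `k` of characteristic `p` all of whose points have a radicially
regular open neighbourhood, there is a finite purely inseparable extension `L ⊇ K(Z)` such that
every point of the normalisation `Z^L` of `Z` in `L` has an open neighbourhood `O` admitting a
finite, universally injective, surjective morphism onto a regular integral separated `k`-scheme
of finite type. -/
theorem exists_normalizationIn_forall_picoverChart (p : ℕ) [Fact p.Prime] (k : Type) [Field k]
    [CharP k p] (Z : Scheme.{0}) [IsIntegral Z] (f : Z ⟶ Spec (.of k)) [IsSeparated f]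
    [LocallyOfFiniteType f] [QuasiCompact f]
    (hN : ∀ z : Z, IsIntegrallyClosed (Z.presheaf.stalk z))
    (hL : ∀ z : Z, ∃ U : Z.Opens, z ∈ U ∧ ∃ (W : Scheme.{0}) (h : W ⟶ (U : Scheme.{0})),
      IsIntegral W ∧ Scheme.IsRegular W ∧ IsFinite h ∧ UniversallyInjective h ∧
        Function.Surjective h.base) :
    ∃ (L : Type) (_ : Field L) (_ : Algebra Z.functionField L),
      FiniteDimensional Z.functionField L ∧ IsPurelyInseparable Z.functionField L ∧
      ∀ y : normalizationIn Z L, ∃ O : (normalizationIn Z L).Opens, y ∈ O ∧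
        ∃ (Y : Scheme.{0}) (fY : Y ⟶ Spec (.of k)) (g : (O : Scheme.{0}) ⟶ Y), IsSeparated fY ∧
          LocallyOfFiniteType fY ∧ QuasiCompact fY ∧ IsIntegral Y ∧ Scheme.IsRegular Y ∧
          IsFinite g ∧ UniversallyInjective g ∧ Function.Surjective g.base := by
  classical
  haveI : IsLocallyNoetherian Z := LocallyOfFiniteType.isLocallyNoetherian f
  /- H1: a finite radicially regular atlas `U (v i)`, `i : Fin n`. -/
  choose U hU hRR using hL
  haveI : CompactSpace Z := QuasiCompact.compactSpace_of_compactSpace f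
  obtain ⟨t, ht⟩ := isCompact_univ.elim_finite_subcover (fun z : Z => ((U z : Z.Opens) : Set Z))
    (fun z => (U z).2) (fun z _ => Set.mem_iUnion.mpr ⟨z, hU z⟩)
  let v : Fin t.card → Z := fun i => ((t.equivFin.symm i : t) : Z)
  have hcov : ∀ x : Z, ∃ i, x ∈ U (v i) := by
    intro x
    obtain ⟨z, hzt, hxz⟩ := Set.mem_iUnion₂.mp (ht (Set.mem_univ x))
    refine ⟨t.equivFin ⟨z, hzt⟩, ?_⟩
    simp only [v, Equiv.symm_apply_apply]
    exact hxz
  /- the radicially regular data of the charts -/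
  choose W w hW hreg hfin hui hsurj using hRR
  have hWn : ∀ z (x : W z), IsIntegrallyClosed ((W z).presheaf.stalk x) := fun z x =>
    haveI := hreg z x
    isIntegrallyClosed_of_isRegularLocalRing _
  /- H2: extend every chart cover to a global finite radicial normal cover `h z : Z₁ z → Z`. -/
  have hext : ∀ z : Z, ∃ (Z₁ : Scheme.{0}) (h : Z₁ ⟶ Z) (i : W z ⟶ Z₁), IsIntegral Z₁ ∧
      (∀ x : Z₁, IsIntegrallyClosed (Z₁.presheaf.stalk x)) ∧ IsFinite h ∧
      UniversallyInjective h ∧ Function.Surjective h.base ∧ IsOpenImmersion i ∧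
        IsPullback i (w z) h (U z).ι := by
    intro z
    haveI := hW z; haveI := hfin z; haveI := hui z
    exact exists_finite_radicial_cover_extending p k Z f hN (U z) (W z) (w z) (hsurj z) (hWn z)
  choose Z₁ h ι hZ₁ _hZ₁n hhfin hhui hhsurj hιopen hsq using hext
  haveI : ∀ z, IsIntegral (Z₁ z) := hZ₁
  haveI : ∀ z, IsFinite (h z) := hhfin
  haveI : ∀ z, UniversallyInjective (h z) := hhui
  haveI : ∀ z, IsDominant (h z) := fun z => ⟨(hhsurj z).denseRange⟩
  haveI : ∀ z, IsOpenImmersion (ι z) := hιopen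
  /- H3: one finite purely inseparable `L` containing every `K(Z₁ (v i))`. -/
  haveI : ∀ i : Fin t.card, IsPurelyInseparable Z.functionField (FunctionFieldOver (h (v i))) :=
    fun i => Picover.FunctionFieldRadicial.stub_functionFieldRadicial (Z₁ (v i)) Z (h (v i))
  obtain ⟨L, _, _, hfd, hpi, hemb⟩ := exists_common_purelyInseparable_extension Z.functionField
    (fun i : Fin t.card => FunctionFieldOver (h (v i)))
  haveI := hfd
  haveI := hpi
  have e : ∀ i : Fin t.card, FunctionFieldOver (h (v i)) →ₐ[Z.functionField] L :=
    fun i => (hemb i).some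
  /- H4: `Z^L → Z₁ (v i)` finite, universally injective, surjective over `Z`. -/
  have hdom : ∀ i : Fin t.card, ∃ δ : normalizationIn Z L ⟶ Z₁ (v i),
      δ ≫ h (v i) = normalizationInι Z L ∧ IsFinite δ ∧ UniversallyInjective δ ∧
        Function.Surjective δ.base := fun i =>
    exists_finite_universallyInjective_hom_normalizationIn p k Z f hN L (h (v i)) (e i)
  choose δ hδ hδfin hδui hδsurj using hdom
  refine ⟨L, inferInstance, inferInstance, hfd, hpi, fun y => ?_⟩
  /- the chart at `y`: `i` with `ν y ∈ U (v i)`, `O := (δ i)⁻¹ (range ι)`. -/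
  obtain ⟨i, hi⟩ := hcov (normalizationInι Z L y)
  have hy1 : h (v i) (δ i y) = normalizationInι Z L y := by
    have := congrArg (fun φ => φ.base y) (hδ i)
    simpa [Scheme.Hom.comp_base] using this
  -- `δ i y` lies over `U (v i)`, hence in the range of `ι (v i)` (`W = Z₁ ×_Z U`)
  have hyO : y ∈ (δ i) ⁻¹ᵁ (ι (v i)).opensRange := by
    show (δ i).base y ∈ Set.range (ι (v i)).base
    have h3 : (δ i).base y ∈ (h (v i)).base ⁻¹' Set.range (U (v i)).ι.base := by
      rw [Scheme.Opens.range_ι]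
      show h (v i) (δ i y) ∈ (U (v i) : Set Z)
      rw [hy1]
      exact hi
    rw [← Scheme.Pullback.range_fst (h (v i)) (U (v i)).ι, ← (hsq (v i)).isoPullback_inv_fst,
      Scheme.Hom.comp_base, TopCat.coe_comp, Set.range_comp] at h3
    obtain ⟨_, ⟨q, rfl⟩, hq⟩ := h3
    exact ⟨_, hq⟩
  haveI := hW (v i); haveI := hfin (v i); haveI := hui (v i)
  haveI := hδfin i; haveI := hδui i
  -- the chart: `O → range ι ≅ W (v i)`, finite, universally injective, surjective
  let O : (normalizationIn Z L).Opens := (δ i) ⁻¹ᵁ (ι (v i)).opensRange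
  let g : (O : Scheme.{0}) ⟶ W (v i) :=
    (δ i ∣_ (ι (v i)).opensRange) ≫ (ι (v i)).isoOpensRange.inv
  haveI : UniversallyInjective (δ i ∣_ (ι (v i)).opensRange) :=
    IsZariskiLocalAtTarget.restrict ‹_› _
  have hsurj' : Surjective (δ i ∣_ (ι (v i)).opensRange) :=
    IsZariskiLocalAtTarget.restrict (P := @Surjective) ⟨hδsurj i⟩ _
  have hgui : UniversallyInjective g := MorphismProperty.comp_mem _ _ _ ‹_› inferInstance
  have hgsurj : Function.Surjective g.base := by
    simp only [g, Scheme.Hom.comp_base, TopCat.coe_comp]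
    exact (Scheme.homeoOfIso (ι (v i)).isoOpensRange.symm).surjective.comp hsurj'.1
  -- `W (v i)` over `k`
  haveI : IsSeparated (w (v i) ≫ (U (v i)).ι ≫ f) := inferInstance
  haveI : LocallyOfFiniteType (w (v i) ≫ (U (v i)).ι ≫ f) := inferInstance
  haveI : QuasiCompact (w (v i) ≫ (U (v i)).ι ≫ f) := inferInstance
  exact ⟨O, hyO, W (v i), w (v i) ≫ (U (v i)).ι ≫ f, g, inferInstance, inferInstance,
    inferInstance, hW (v i), hreg (v i), inferInstance, hgui, hgsurj⟩

section Assembly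

open Summit.ResolutionOfSingularities.ResolutionOfSingularities.Theses.PAlteration (Picover)

/-- **`stub_radicialPatching` over ANY field of characteristic `p`, from `Picover`, two-model
patching and Nagata** (the plan's assembly §3; perfectness is not used). For a NORMAL integral
separated scheme `Z` of finite type over a field `k` of characteristic `p` all of whose points
have a radicially regular open neighbourhood, the conclusion of the crux `Pialt` holds at `Z`,
modulo the route's crux `Picover`, `ProperModel.TwoModelPatching p` and
`NagataCompactification`: every point of `Z^L` (`exists_normalizationIn_forall_picoverChart`)
has an open neighbourhood resolved by `Picover`, so `Z^L` is resolvable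
(`hasResolution_of_forall_exists_open_hasResolution`) and
`pialtConclusion_of_hasResolution_normalizationIn` gives the purely inseparable regular
alteration of `Z`. -/
theorem radicialPatching_of_picover_of_twoModelPatching_anyField (hPc : Picover)
    (hNag : NagataCompactification.{0}) (p : ℕ) (hp : p.Prime)
    (hT : ProperModel.TwoModelPatching.{0} p) (k : Type) [Field k] [CharP k p]
    (Z : Scheme.{0}) (f : Z ⟶ Spec (.of k)) [IsSeparated f] [LocallyOfFiniteType f]
    [QuasiCompact f] [IsIntegral Z] (hN : ∀ z : Z, IsIntegrallyClosed (Z.presheaf.stalk z))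
    (hL : ∀ z : Z, ∃ U : Z.Opens, z ∈ U ∧ ∃ (W : Scheme.{0}) (h : W ⟶ (U : Scheme.{0})),
      IsIntegral W ∧ Scheme.IsRegular W ∧ IsFinite h ∧ UniversallyInjective h ∧
        Function.Surjective h.base) :
    ∃ (Z' : Scheme.{0}) (g : Z' ⟶ Z), IsProper g ∧ IsIntegral Z' ∧ Scheme.IsRegular Z' ∧
      Function.Surjective g.base ∧ ∃ U : Z.Opens, Dense (U : Set Z) ∧ IsFinite (g ∣_ U) ∧
        UniversallyInjective (g ∣_ U) := by
  haveI : Fact p.Prime := ⟨hp⟩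
  obtain ⟨L, _, _, hfd, hpi, hcharts⟩ := exists_normalizationIn_forall_picoverChart p k Z f hN hL
  haveI := hfd
  haveI := hpi
  -- `Z^L` is integral, finite over `Z`, hence separated / of finite type / quasi-compact over `k`
  haveI : IsFinite (normalizationInι Z L) := isFinite_normalizationInι Z L f
  haveI : IsSeparated (normalizationInι Z L ≫ f) := inferInstance
  haveI : LocallyOfFiniteType (normalizationInι Z L ≫ f) := inferInstance
  haveI : QuasiCompact (normalizationInι Z L ≫ f) := inferInstance
  -- every point of `Z^L` has a resolvable open neighbourhood (`Picover` on the chart)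
  have hloc : ∀ y : normalizationIn Z L, ∃ O : (normalizationIn Z L).Opens, y ∈ O ∧
      Scheme.HasResolution (O : Scheme.{0}) := by
    intro y
    obtain ⟨O, hy, Y, fY, g, hs, hl, hq, hY, hreg, hfin, hui, hsurj⟩ := hcharts y
    haveI : Nonempty (O : Scheme.{0}) := ⟨⟨y, hy⟩⟩
    haveI : IsIntegral (O : Scheme.{0}) := isIntegral_of_isOpenImmersion O.ι
    exact ⟨O, hy, hPc p hp k Y O fY g hs hl hq hY hreg inferInstance hfin hui hsurj⟩
  have hres : Scheme.HasResolution (normalizationIn Z L) :=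
    hasResolution_of_forall_exists_open_hasResolution hNag hT k (normalizationIn Z L)
      (normalizationInι Z L ≫ f) hloc
  exact pialtConclusion_of_hasResolution_normalizationIn hp k Z f hN L hres

end Assembly

end Summit.ResolutionOfSingularities.ResolutionOfSingularities.Theorems.Pialt.RadiciallyRegular

end
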